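import Mathlib
import Summits.Ventures.HodgeRepro2.T6A3EigenBasis
import Summits.Ventures.HodgeRepro2.T6A1Glue

/-!
# T6A1EigenBasis — A1's eigenbasis of `H¹(B, ℂ)` in t6-p3's `EigenBasis` shape (TIER4 (A0.4), (A0.6))

Tier-6 sub-goal A1 (route/T6-A1-t6-p1.md §3; the lead's M1 composition contract, STATUS l. 4494). The
A3 model (`T6A3Model.EigenBasis`) wants the six embeddings `K → ℂ` paired into three conjugate pairs
`emb (ν, false)`, `emb (ν, true) = conj ∘ emb (ν, false)` (TIER4 (A0.1): `Σ = {τ_1, τ_2, τ_3, τ̄_1, τ̄_2, τ̄_3}`)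
and one non-zero eigenvector `eK σ` per embedding (TIER4 (A0.6): `e_{i,σ} = single i (eK σ)`). The pairing
is built from one CM type of the face (`embPair`: a CM type contains exactly one of each conjugate pair,
p1's `IsCMType`), the eigenvectors from `T6A1Glue.exists_eigenvectors`, and the basis from t6-p3's
`EigenBasis.ofLines`. `A1_eigenBasis` packages everything the composition needs.
-/

namespace Summit.Ventures.HodgeRepro2.T6.A1EigenBasis

open A1Glue A3EigenBasis NumberField

variable {K : Type*} [Field K] [NumberField K]

omit [NumberField K] in
/-- In a CM type, the conjugate of a member is not a member. -/
theorem conjugate_notMem {Φ : Set (K →+* ℂ)} (hΦ : IsCMType K Φ) {φ : K →+* ℂ} (hφ : φ ∈ Φ) :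
    ComplexEmbedding.conjugate φ ∉ Φ :=
  ((hΦ φ).resolve_right fun h => h.2 hφ).2

omit [NumberField K] in
/-- A non-member of a CM type has its conjugate in the type. -/
theorem conjugate_mem_of_notMem {Φ : Set (K →+* ℂ)} (hΦ : IsCMType K Φ) {φ : K →+* ℂ} (hφ : φ ∉ Φ) :
    ComplexEmbedding.conjugate φ ∈ Φ :=
  ((hΦ φ).resolve_left fun h => hφ h.1).1

/-- A CM type of a sextic field has exactly three elements. -/
theorem card_cmType (hdeg : Module.finrank ℚ K = 6) {Φ : Set (K →+* ℂ)} (hΦ : IsCMType K Φ) :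
    Nat.card Φ = 3 := by
  classical
  have hcard : Fintype.card (K →+* ℂ) = 6 := by rw [NumberField.Embeddings.card K ℂ, hdeg]
  -- conjugation is a bijection between Φ and its complement
  let e : Φ ≃ {φ : K →+* ℂ // φ ∉ Φ} :=
    { toFun := fun φ => ⟨ComplexEmbedding.conjugate φ, conjugate_notMem hΦ φ.2⟩
      invFun := fun φ => ⟨ComplexEmbedding.conjugate φ, conjugate_mem_of_notMem hΦ φ.2⟩
      left_inv := fun φ => by ext; simp
      right_inv := fun φ => by ext; simp }
  have h2 : Fintype.card {φ : K →+* ℂ // φ ∉ Φ} = 6 - Fintype.card Φ := by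
    rw [← hcard]
    exact Fintype.card_subtype_compl _
  have h3 : Fintype.card {φ : K →+* ℂ // φ ∉ Φ} = Fintype.card Φ := (Fintype.card_congr e).symm
  have h4 : Fintype.card Φ ≤ 6 := by rw [← hcard]; exact Fintype.card_subtype_le _
  rw [Nat.card_eq_fintype_card]
  omega

/-- The conjugate pairing of the embeddings from a CM type `Φ` of a sextic field:
`(ν, false) ↦ φ_ν ∈ Φ`, `(ν, true) ↦ φ̄_ν`. -/
noncomputable def embPair (hdeg : Module.finrank ℚ K = 6) {Φ : Set (K →+* ℂ)} (hΦ : IsCMType K Φ) :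
    Fin 3 × Bool ≃ (K →+* ℂ) := by
  classical
  let e : Fin 3 ≃ Φ := (Fintype.equivFinOfCardEq (by
    rw [← Nat.card_eq_fintype_card]; exact card_cmType hdeg hΦ)).symm
  refine Equiv.ofBijective (fun p => if p.2 then ComplexEmbedding.conjugate (e p.1 : K →+* ℂ)
    else (e p.1 : K →+* ℂ)) ⟨?_, ?_⟩
  · rintro ⟨ν, s⟩ ⟨ν', s'⟩ h
    simp only at h
    cases s <;> cases s' <;> simp only [Bool.false_eq_true, if_false, if_true] at h
    · rw [Prod.mk.injEq]
      exact ⟨e.injective (Subtype.ext h), rfl⟩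
    · exact (conjugate_notMem hΦ (e ν').2 (h ▸ (e ν).2)).elim
    · exact (conjugate_notMem hΦ (e ν).2 (h ▸ (e ν').2)).elim
    · rw [Prod.mk.injEq]
      refine ⟨e.injective (Subtype.ext ?_), rfl⟩
      have := congrArg ComplexEmbedding.conjugate h
      simpa using this
  · intro ρ
    by_cases h : ρ ∈ Φ
    · exact ⟨(e.symm ⟨ρ, h⟩, false), by simp⟩
    · refine ⟨(e.symm ⟨ComplexEmbedding.conjugate ρ, conjugate_mem_of_notMem hΦ h⟩, true), ?_⟩
      simp

/-- The pairing pairs each embedding with its conjugate. -/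
theorem embPair_true (hdeg : Module.finrank ℚ K = 6) {Φ : Set (K →+* ℂ)} (hΦ : IsCMType K Φ)
    (ν : Fin 3) : embPair hdeg hΦ (ν, true) = ComplexEmbedding.conjugate (embPair hdeg hΦ (ν, false)) := by
  simp [embPair, Equiv.ofBijective_apply]

/-- The first member of each pair lies in the chosen CM type. -/
theorem embPair_false_mem (hdeg : Module.finrank ℚ K = 6) {Φ : Set (K →+* ℂ)} (hΦ : IsCMType K Φ)
    (ν : Fin 3) : embPair hdeg hΦ (ν, false) ∈ Φ := by
  simp only [embPair, Equiv.ofBijective_apply, Bool.false_eq_true, if_false]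
  exact Subtype.mem _

variable (K)

/-- A1's EIGENBASIS (TIER4 (A0.4)/(A0.6) in the A3 model's shape): an `EigenBasis K` whose embeddings
are paired by complex conjugation (`(ν, true) = conj ∘ (ν, false)`) with the first members in the face's
first CM type, together with the eigenvectors `eK` (`E.eB (i, σ) = single i (eK σ)`, `eK σ ≠ 0`,
`span ℂ (range eK) = ⊤`) — the data t6-p2's `A2_inputs` and t6-p3's `A3_main` consume. -/
theorem exists_eigenBasis (F : FaceSetting K) :
    ∃ (E : A3Model.EigenBasis K) (eK : (K →+* ℂ) → KC K),
      (∀ i σ, E.eB (i, σ) = LinearMap.single ℂ (fun _ : Fin 4 => KC K) i (eK σ)) ∧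
      (∀ σ, eK σ ≠ 0) ∧ Submodule.span ℂ (Set.range eK) = ⊤ ∧
      (∀ ν, E.emb (ν, true) = ComplexEmbedding.conjugate (E.emb (ν, false))) ∧
      (∀ ν, E.emb (ν, false) ∈ F.T 0) := by
  obtain ⟨v, hv0, hv, hspan⟩ := exists_eigenvectors K
  refine ⟨ofLines (embPair F.deg6 (F.face.1 0)) v hv hspan, v, fun i σ => ofLines_eB _ _ _ _ i σ,
    hv0, hspan, fun ν => ?_, fun ν => ?_⟩
  · rw [ofLines_emb]
    exact embPair_true F.deg6 (F.face.1 0) ν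
  · rw [ofLines_emb]
    exact embPair_false_mem F.deg6 (F.face.1 0) ν

end Summit.Ventures.HodgeRepro2.T6.A1EigenBasis
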